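import Summits.CriticalPhenomena.PercolationContinuityZ3.Theorems.PercNearOneGluingNoHeavyLowerTailCILTwoSteinerTools
import Summits.CriticalPhenomena.PercolationContinuityZ3.Theorems.PercNearOneGluingNoHeavyLowerTailCILSteinerDegreeTwo
import HarnessLib

/-!
# `NoHeavyLowerTail` (stmt-CriticalPhenomena-4575) — the series-reduced graph of a degree-two observer: transport identities

Support file (prover `prim-hp-2`, deletion–contraction / pivotal-edge line; `--supports stmt-CriticalPhenomena-4575`).
No definitions, no named facts, no sorries.  Notation as in `…CILTwoSteinerTools.lean`: `μ_w = prodBernoulli w`, relays `A`,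
observer `o ∉ A`, level `j`, `L_v = {1 ≤ |π(v)| ≤ j}`, `R_a = {|π(a)| ≤ j}`, `w⁰ = G − o` (`pinW w {pairs at o} ∅`),
`e = s(o,x)`, `f = s(o,y)`, `g = s(x,y)`, `α = w e`, `β = w f`, `γ = w g`.

THE SERIES-REDUCED GRAPH `w₃` of `o` (when the positive pairs at `o` go to `x`, `y` only): pairs at `o` closed, the pair
`x–y` raised to `1 − (1−γ)(1−αβ)`, everything else unchanged (`HullPort.series_reduction`, prover prim-hp-3, shows that every
vertex `≠ o` keeps the law of its relay set); below `w₃` is ANY weight function with these defining properties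
(`h₃z`, `h₃zz`, `h₃off`, `h₃xy`).

* `real_L_update_wzero_one` — `μ_{w⁰[e↦1]}(L_o) = μ_{w⁰}(L_x)`;
* `real_L_update_wzero_one_one` — `μ_{w⁰[e↦1][f↦1]}(L_o) = μ_{w⁰[g↦1]}(L_x)` (any `γ`: the event `{1 ≤ |π(x) ∪ π(y)| ≤ j}` is
  insensitive to the pair `g`);
* `seriesReduced_eq_off`, `real_seriesReduced` — `w₃` agrees with `w⁰` off `g`, hence
  `μ_{w₃}(S) = (1−αβ)·μ_{w⁰}(S) + αβ·μ_{w⁰[g↦1]}(S)` for every event `S`;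
* `lightness_seriesReduced` — `μ_w(R_a) = μ_{w₃}(R_a)` for every relay `a` (= `HullPort.series_reduction`).
The observer series law and the modular two-Steiner step built on these are in `…CILTwoSteinerSeries.lean`.
-/

noncomputable section

namespace Summit.CriticalPhenomena.PercolationContinuityZ3.Theorems

open MeasureTheory Set Literature.Probability.LatticeModels Literature.Probability.Percolation
open scoped Classical BigOperators

variable {n : ℕ}

namespace CILTwoSteiner

open CILOneSteiner ChampionStability MergeStability RelayNbhd


/-- `μ_{w⁰[s(o,x)↦1]}(L_o) = μ_{w⁰}(L_x)`: gluing the isolated `o` to `x` makes `π(o) = π(x)`. [folklore] -/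
theorem real_L_update_wzero_one (w : Sym2 (Fin n) → unitInterval) (A : Finset (Fin n)) (o x : Fin n) (j : ℕ)
    (ho : o ∉ A) (hxo : x ≠ o) :
    (prodBernoulli (Function.update (pinW w {e : Sym2 (Fin n) | o ∈ e ∧ ¬ e.IsDiag} ∅) s(o, x) 1)).real
        {ω : BondConfig (Fin n) | 1 ≤ (A.filter fun z => ω ∈ openConn o z).card ∧
          (A.filter fun z => ω ∈ openConn o z).card ≤ j} =
      (prodBernoulli (pinW w {e : Sym2 (Fin n) | o ∈ e ∧ ¬ e.IsDiag} ∅)).real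
        {ω : BondConfig (Fin n) | 1 ≤ (A.filter fun z => ω ∈ openConn x z).card ∧
          (A.filter fun z => ω ∈ openConn x z).card ≤ j} := by
  haveI : ∀ u : Sym2 (Fin n) → unitInterval, IsProbabilityMeasure (prodBernoulli u) := fun u => inferInstance
  have hox : o ≠ x := fun h => hxo h.symm
  rw [real_update_wzero_one w hxo]
  refine measureReal_congr_of_null _ _ _ {ω | ∀ u : Fin n, u ≠ o → s(o, u) ∉ ω}
    (real_compl_isolated_eq_zero w o) ?_
  ext ω
  simp only [mem_inter_iff, mem_setOf_eq, mem_preimage]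
  have hfilt : (∀ u : Fin n, u ≠ o → s(o, u) ∉ ω) →
      (A.filter fun z => insert s(o, x) ω ∈ openConn o z) = (A.filter fun z => ω ∈ openConn x z) := by
    intro hω
    refine Finset.filter_congr fun z hz => ?_
    have hzo : z ≠ o := fun h => ho (h ▸ hz)
    show (openGraph (insert s(o, x) ω)).Reachable o z ↔ (openGraph ω).Reachable x z
    exact reachable_o_insert_iff_of_isolated hox hω hzo
  constructor
  · rintro ⟨h, hω⟩
    rw [hfilt hω] at h
    exact ⟨h, hω⟩
  · rintro ⟨h, hω⟩
    rw [hfilt hω]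
    exact ⟨h, hω⟩

/-- `μ_{w⁰[s(o,x)↦1][s(o,y)↦1]}(L_o) = μ_{w⁰[s(x,y)↦1]}(L_x)`: gluing the isolated `o` to `x` and `y` is, for the relay
content of the observer's cluster, adding the pair `x–y` and observing from `x`. [folklore] -/
theorem real_L_update_wzero_one_one (w : Sym2 (Fin n) → unitInterval) (A : Finset (Fin n)) (o x y : Fin n) (j : ℕ)
    (ho : o ∉ A) (hxo : x ≠ o) (hyo : y ≠ o) (hxy : x ≠ y) :
    (prodBernoulli (Function.update (Function.update
        (pinW w {e : Sym2 (Fin n) | o ∈ e ∧ ¬ e.IsDiag} ∅) s(o, x) 1) s(o, y) 1)).real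
        {ω : BondConfig (Fin n) | 1 ≤ (A.filter fun z => ω ∈ openConn o z).card ∧
          (A.filter fun z => ω ∈ openConn o z).card ≤ j} =
      (prodBernoulli (Function.update (pinW w {e : Sym2 (Fin n) | o ∈ e ∧ ¬ e.IsDiag} ∅) s(x, y) 1)).real
        {ω : BondConfig (Fin n) | 1 ≤ (A.filter fun z => ω ∈ openConn x z).card ∧
          (A.filter fun z => ω ∈ openConn x z).card ≤ j} := by
  haveI : ∀ u : Sym2 (Fin n) → unitInterval, IsProbabilityMeasure (prodBernoulli u) := fun u => inferInstance
  have hox : o ≠ x := fun h => hxo h.symm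
  have hoy : o ≠ y := fun h => hyo h.symm
  set w0 : Sym2 (Fin n) → unitInterval := pinW w {e : Sym2 (Fin n) | o ∈ e ∧ ¬ e.IsDiag} ∅ with hw0
  have hg_not : s(x, y) ∉ {e : Sym2 (Fin n) | o ∈ e ∧ ¬ e.IsDiag} := by
    rintro ⟨hoe, -⟩
    rcases Sym2.mem_iff.1 hoe with h | h
    · exact hox h
    · exact hoy h
  -- the `g`-insensitive event `E = {1 ≤ |π(x) ∪ π(y)| ≤ j}`
  set E : Set (BondConfig (Fin n)) := {ω : BondConfig (Fin n) |
      1 ≤ (A.filter fun z => ω ∈ openConn x z ∨ ω ∈ openConn y z).card ∧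
        (A.filter fun z => ω ∈ openConn x z ∨ ω ∈ openConn y z).card ≤ j} with hE
  have hinsE : ∀ ω : BondConfig (Fin n),
      (A.filter fun z => insert s(x, y) ω ∈ openConn x z) =
        (A.filter fun z => ω ∈ openConn x z ∨ ω ∈ openConn y z) := by
    intro ω
    refine Finset.filter_congr fun z _ => ?_
    exact ChampionStability.reachable_insert_left_iff ω hxy z
  have hpreLx : (fun ω : BondConfig (Fin n) => insert s(x, y) ω) ⁻¹'
      {ω : BondConfig (Fin n) | 1 ≤ (A.filter fun z => ω ∈ openConn x z).card ∧
        (A.filter fun z => ω ∈ openConn x z).card ≤ j} = E := by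
    ext ω
    simp only [mem_preimage, mem_setOf_eq, hE]
    rw [hinsE ω]
  have hpreE : (fun ω : BondConfig (Fin n) => insert s(x, y) ω) ⁻¹' E = E := by
    ext ω
    simp only [mem_preimage, mem_setOf_eq, hE]
    have hfilt : (A.filter fun z => insert s(x, y) ω ∈ openConn x z ∨ insert s(x, y) ω ∈ openConn y z) =
        (A.filter fun z => ω ∈ openConn x z ∨ ω ∈ openConn y z) := by
      refine Finset.filter_congr fun z _ => ?_
      show ((openGraph (insert s(x, y) ω)).Reachable x z ∨ (openGraph (insert s(x, y) ω)).Reachable y z) ↔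
        ((openGraph ω).Reachable x z ∨ (openGraph ω).Reachable y z)
      have h1 := ChampionStability.reachable_insert_left_iff ω hxy z
      have h2 : (openGraph (insert s(x, y) ω)).Reachable y z ↔
          ((openGraph ω).Reachable y z ∨ (openGraph ω).Reachable x z) := by
        rw [Sym2.eq_swap]; exact ChampionStability.reachable_insert_left_iff ω (Ne.symm hxy) z
      rw [h1, h2]
      tauto
    rw [hfilt]
  -- right-hand side `= μ_{w0[g↦0]}(E)`
  have hR : (prodBernoulli (Function.update w0 s(x, y) 1)).real
      {ω : BondConfig (Fin n) | 1 ≤ (A.filter fun z => ω ∈ openConn x z).card ∧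
        (A.filter fun z => ω ∈ openConn x z).card ≤ j} =
      (prodBernoulli (Function.update w0 s(x, y) 0)).real E := by
    rw [tieLiftOne_real_one_eq w0 s(x, y), hpreLx]
  -- `μ_{w0}(E) = μ_{w0[g↦0]}(E)` (insensitivity)
  have hI : (prodBernoulli w0).real E = (prodBernoulli (Function.update w0 s(x, y) 0)).real E := by
    have h := stub_oneBondDecomp_k15 n w0 s(x, y) E
    rw [tieLiftOne_real_one_eq w0 s(x, y), hpreE] at h
    rw [h]; ring
  -- left-hand side `= μ_{w0}(E)` (pointwise on "`o` isolated")
  have hL : (prodBernoulli (Function.update (Function.update w0 s(o, x) 1) s(o, y) 1)).real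
      {ω : BondConfig (Fin n) | 1 ≤ (A.filter fun z => ω ∈ openConn o z).card ∧
        (A.filter fun z => ω ∈ openConn o z).card ≤ j} = (prodBernoulli w0).real E := by
    rw [hw0, real_update_wzero_one_one w hxo hyo hxy, ← hw0]
    refine measureReal_congr_of_null _ _ _ {ω | ∀ u : Fin n, u ≠ o → s(o, u) ∉ ω}
      (by rw [hw0]; exact real_compl_isolated_eq_zero w o) ?_
    ext ω
    simp only [mem_inter_iff, mem_setOf_eq, hE]
    have hfilt : (∀ u : Fin n, u ≠ o → s(o, u) ∉ ω) →
        (A.filter fun z => insert s(o, y) (insert s(o, x) ω) ∈ openConn o z) =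
          (A.filter fun z => ω ∈ openConn x z ∨ ω ∈ openConn y z) := by
      intro hω
      refine Finset.filter_congr fun z hz => ?_
      have hzo : z ≠ o := fun h => ho (h ▸ hz)
      exact reachable_o_insert₂_iff_of_isolated hox hoy hω hzo
    constructor
    · rintro ⟨h, hω⟩
      rw [hfilt hω] at h
      exact ⟨h, hω⟩
    · rintro ⟨h, hω⟩
      rw [hfilt hω]
      exact ⟨h, hω⟩
  rw [hL, hR, hI]

/-- Pairs other than `s(x,y)` have the same weight in the series-reduced graph `w₃` and in `G − o`. [folklore] -/
theorem seriesReduced_eq_off (w w₃ : Sym2 (Fin n) → unitInterval) (o x y : Fin n)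
    (h₃z : ∀ v : Fin n, v ≠ o → w₃ s(o, v) = 0) (h₃zz : w₃ s(o, o) = w s(o, o))
    (h₃off : ∀ e : Sym2 (Fin n), o ∉ e → e ≠ s(x, y) → w₃ e = w e) :
    ∀ e' : Sym2 (Fin n), e' ≠ s(x, y) → w₃ e' = pinW w {e : Sym2 (Fin n) | o ∈ e ∧ ¬ e.IsDiag} ∅ e' := by
  intro e' hne
  by_cases ho' : o ∈ e'
  · obtain ⟨v, rfl⟩ : ∃ v, e' = s(o, v) := by
      induction e' using Sym2.ind with
      | h a b =>
        rcases Sym2.mem_iff.1 ho' with rfl | rfl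
        · exact ⟨b, rfl⟩
        · exact ⟨a, Sym2.eq_swap⟩
    by_cases hvo : v = o
    · subst hvo
      have hdiag : s(v, v) ∉ {e : Sym2 (Fin n) | v ∈ e ∧ ¬ e.IsDiag} := by
        rintro ⟨-, h⟩; exact h (Sym2.mk_isDiag_iff.2 rfl)
      rw [h₃zz, pinW_apply_of_not_mem w ∅ hdiag]
    · rw [h₃z v hvo, pinW_star_mk w hvo]
  · have hmem : e' ∉ {e : Sym2 (Fin n) | o ∈ e ∧ ¬ e.IsDiag} := fun h => ho' h.1
    rw [h₃off e' ho' hne, pinW_apply_of_not_mem w ∅ hmem]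

/-- **Measures under the series-reduced graph.**  With `ε = w(ox)·w(oy)`, `g = s(x,y)`, `w⁰ = G − o`:
`μ_{w₃}(S) = (1 − ε)·μ_{w⁰}(S) + ε·μ_{w⁰[g↦1]}(S)` for every event `S`. [folklore] -/
theorem real_seriesReduced (w w₃ : Sym2 (Fin n) → unitInterval) (o x y : Fin n)
    (h₃z : ∀ v : Fin n, v ≠ o → w₃ s(o, v) = 0) (h₃zz : w₃ s(o, o) = w s(o, o))
    (h₃off : ∀ e : Sym2 (Fin n), o ∉ e → e ≠ s(x, y) → w₃ e = w e)
    (h₃xy : (w₃ s(x, y) : ℝ) = 1 - (1 - (w s(x, y) : ℝ)) * (1 - (w s(o, x) : ℝ) * w s(o, y)))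
    (hox : o ≠ x) (hoy : o ≠ y) (S : Set (BondConfig (Fin n))) :
    (prodBernoulli w₃).real S =
      (1 - (w s(o, x) : ℝ) * w s(o, y)) * (prodBernoulli (pinW w {e : Sym2 (Fin n) | o ∈ e ∧ ¬ e.IsDiag} ∅)).real S +
        (w s(o, x) : ℝ) * w s(o, y) *
          (prodBernoulli (Function.update (pinW w {e : Sym2 (Fin n) | o ∈ e ∧ ¬ e.IsDiag} ∅) s(x, y) 1)).real S := by
  set w0 : Sym2 (Fin n) → unitInterval := pinW w {e : Sym2 (Fin n) | o ∈ e ∧ ¬ e.IsDiag} ∅ with hw0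
  set g : Sym2 (Fin n) := s(x, y) with hg
  have hoff := seriesReduced_eq_off w w₃ o x y h₃z h₃zz h₃off
  have hupd : ∀ t : unitInterval, Function.update w₃ g t = Function.update w0 g t := by
    intro t
    funext e'
    by_cases he : e' = g
    · rw [he, Function.update_self, Function.update_self]
    · rw [Function.update_of_ne he, Function.update_of_ne he, hw0]
      exact hoff e' (by rw [hg] at he; exact he)
  have hg_not : g ∉ {e : Sym2 (Fin n) | o ∈ e ∧ ¬ e.IsDiag} := by
    rintro ⟨hoe, -⟩
    rcases Sym2.mem_iff.1 hoe with h | h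
    · exact hox h
    · exact hoy h
  have hw0g : (w0 g : ℝ) = w s(x, y) := by rw [hw0, pinW_apply_of_not_mem w ∅ hg_not]
  have h3 := stub_oneBondDecomp_k15 n w₃ g S
  rw [hupd 0, hupd 1, hg, h₃xy] at h3
  have h0 := stub_oneBondDecomp_k15 n w0 g S
  rw [hw0g] at h0
  rw [h3]
  have h0' : (prodBernoulli (Function.update w0 s(x, y) 0)).real S * (1 - (w s(x, y) : ℝ)) =
      (prodBernoulli w0).real S - (w s(x, y) : ℝ) * (prodBernoulli (Function.update w0 s(x, y) 1)).real S := by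
    rw [h0]; ring
  linear_combination (1 - (w s(o, x) : ℝ) * w s(o, y)) * h0'

/-- The series-reduced graph has the same relay law as `w` (for use by the champion bookkeeping). -/
theorem lightness_seriesReduced (w w₃ : Sym2 (Fin n) → unitInterval) (A : Finset (Fin n)) (o x y : Fin n) (j : ℕ)
    (ho : o ∉ A) (hxo : x ≠ o) (hyo : y ≠ o) (hxy : x ≠ y)
    (hiso : ∀ v : Fin n, v ≠ o → v ≠ x → v ≠ y → (w s(o, v) : ℝ) = 0)
    (h₃z : ∀ v : Fin n, v ≠ o → w₃ s(o, v) = 0) (h₃zz : w₃ s(o, o) = w s(o, o))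
    (h₃off : ∀ e : Sym2 (Fin n), o ∉ e → e ≠ s(x, y) → w₃ e = w e)
    (h₃xy : (w₃ s(x, y) : ℝ) = 1 - (1 - (w s(x, y) : ℝ)) * (1 - (w s(o, x) : ℝ) * w s(o, y)))
    (a : Fin n) (ha : a ∈ A) :
    (prodBernoulli w).real {ω : BondConfig (Fin n) | (A.filter fun z => ω ∈ openConn a z).card ≤ j} =
      (prodBernoulli w₃).real {ω : BondConfig (Fin n) | (A.filter fun z => ω ∈ openConn a z).card ≤ j} := by
  have hao : a ≠ o := fun h => ho (h ▸ ha)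
  exact HullPort.series_reduction w w₃ A o x y ho (fun h => hxo h.symm) (fun h => hyo h.symm) hxy
    (fun v hvo hvx hvy => Subtype.ext (hiso v hvo hvx hvy)) h₃z h₃zz h₃off h₃xy a hao (fun F => F.card ≤ j)

end CILTwoSteiner

end Summit.CriticalPhenomena.PercolationContinuityZ3.Theorems

end
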